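import Literature.NumberTheory.GaloisRepresentations.CorestrictionSubgroupOfConj
import HarnessLib

/-!
# The relative corestriction along nested normal subgroups commutes with the ambient conjugation
# action, all degrees: `cor_{V/V'} ∘ (g ·) = (g ·) ∘ cor_{V/V'}` on `H^q(V', M) → H^q(V, M)` (part II)

Topic `NumberTheory/GaloisRepresentations`; namespace `Literature.NumberTheory.GaloisRepresentations`.
Definitions with bodies (two evaluation morphisms, the relative corestriction `relCor`) and theorems; no
named fact, no instance, no `sorry`. Part I: `CorestrictionSubgroupOfConj.lean`.

SETTING. `Γ` profinite, `V' ≤ V ≤ Γ` closed NORMAL subgroups of `Γ` with `[V : V']` finite, `M` a discrete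
`Γ`-module (`ρ`), `g ∈ Γ` (typically `g ∉ V`: the generators `γ₁, γ₂` of a `ℤ_p²`-tower acting on the
cohomology of its layers `V = V_n`, `V' = V_{n+1}`). The tree's all-degree corestriction `cor S σ q`
(`Corestriction.lean`, Serre I §2.5: Shapiro extension followed by the norm of the induced module) of the
profinite group `↥V` along `S = V'.subgroupOf V` with coefficients `σ = M|_V`, read on `H^q(V', M)` through the
tautological comparison `toSubgroupOf` (`ContinuousCorestriction.lean`), is the transition map
`relCor : H^q(V', M) → H^q(V, M)` of the inverse systems `(H^q(V_n, M))_n` of Iwasawa theory; the action of `g`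
on both sides is the tree's `conjMap ρ.toTopRep _ g q` (the pair `(x ↦ g⁻¹xg, m ↦ g·m)`). MAIN STATEMENT
(`relCor_conjMap`, Neukirch–Schmidt–Wingberg I §5 Prop. 1.5.4: `cor` commutes with `σ_*`):

  `relCor (g · z) = g · relCor z`   for `z ∈ H^q(V', M)`, every `q`,

i.e. the compatible families `(y_n)_n`, `cor y_{n+1} = y_n`, are stable under `Γ` — the input making
`lim←_n H^q(V_n, M)` a module over the completed group ring through `T_i ↦ γ_i − 1`. The tree previously had
the special cases `cor_conjMap_one/_two` (`V = Γ`, where `cor` KILLS the action) and the degree-`1` transfer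
form `coresLe_conjMap`.

PROOF (Serre I §2.5 through the Shapiro isomorphism; no inner-automorphism lemma is needed, hence all
degrees): `cor = H(N) ∘ sh⁻¹` (`cor_apply`, `sh_extMap`, `shapiro_map_injective/surjective`). The pair
`(c_g, T_g)` of part I induces `Θ_g` on `H^q(V, M_V^S(M))` with (i) `sh ∘ Θ_g = (g ·) ∘ sh` — both are the
map of the SAME pair `(S → V, s ↦ g⁻¹sg; F ↦ g·F(1))` (`shMap_thetaConj`) — and (ii)
`H(N) ∘ Θ_g = (g ·) ∘ H(N)` — both are the map of the pair `(c_g, F ↦ g·N(F))` because `N ∘ T_g = g ∘ N`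
(`cohomologyMap_normCoind_thetaConj`). Hence `cor_conjMapSubOf`; with the equivariance of `toSubgroupOf`
(part I) this is `relCor_conjMap`.

## References
* J.-P. Serre, *Galois Cohomology* (1997), I §2.5 (induced modules, corestriction). [SerreGaloisCohomology1997]
* J. Neukirch, A. Schmidt, K. Wingberg, *Cohomology of Number Fields* (2008), I §5 Prop. 1.5.3–1.5.4
  (transitivity; `cor`, `res` commute with conjugation `σ_*`). [NeukirchSchmidtWingberg2008]
-/

noncomputable section

open CategoryTheory Function

universe u

namespace Literature.NumberTheory.GaloisRepresentations

open _root_.TopRep _root_.ContRepresentation _root_.ContinuousCohomology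
open Literature.NumberTheory.EllipticCurves (subgroupConj subgroupConj_apply_coe)

section RelCor

variable {Γ : Type u} [Group Γ] [TopologicalSpace Γ] [IsTopologicalGroup Γ] [CompactSpace Γ]
  [T2Space Γ] [TotallyDisconnectedSpace Γ]
variable (V V' : Subgroup Γ) [hV : IsClosed (V : Set Γ)] [hV' : IsClosed (V' : Set Γ)]
  [hVn : V.Normal] [hV'n : V'.Normal]
variable {M : Type u} [AddCommGroup M] [TopologicalSpace M] [DiscreteTopology M]
variable (ρ : ContinuousRep Γ ℤ M) (g : Γ)

attribute [local instance] compactSpace_of_isClosed_subgroup discreteTopology_coind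
  isClosed_subgroupOf_of_isClosed

variable (h : V' ≤ V)

/-! ### §3 On cohomology: `sh ∘ Θ_g = (g ·) ∘ sh`, `H(N) ∘ Θ_g = (g ·) ∘ H(N)`, hence `cor ∘ (g ·) = (g ·) ∘ cor` -/

/-- `Θ_g := H^q(c_g, T_g)` on `H^q(V, M_V^S(M))`. [cite: SerreGaloisCohomology1997, I §2.5] -/
abbrev thetaConj (q : ℕ) :
    continuousCohomology q (coindSub V V' ρ).toTopRep ⟶ continuousCohomology q (coindSub V V' ρ).toTopRep :=
  ContinuousCohomology.map (subgroupConj V g) (coindSubConjHom V V' ρ g) q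

/-- The evaluation `F ↦ g · F(1)` along `S → V, s ↦ g⁻¹ s g` — the module half of the pair computing
BOTH `sh ∘ Θ_g` and `(g ·) ∘ sh`. [cite: SerreGaloisCohomology1997, I §2.5] -/
def evalOneConjSub :
    TopRep.res (((subgroupConj V g).comp (subgroupIncl (V'.subgroupOf V)) :
        (V'.subgroupOf V : Subgroup V) →ₜ* V) : (V'.subgroupOf V : Subgroup V) →* V)
      (coindSub V V' ρ).toTopRep ⟶ (repSub V V' ρ).toTopRep :=
  TopRep.ofHom
    { toLinearMap := (ρ g).comp (coindEvalOne (repSub V V' ρ)).hom.toLinearMap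
      cont := continuous_of_discreteTopology
      isIntertwining' := fun s => by
        ext F
        change ρ g (((((coindSub V V' ρ) (subgroupConj V g (s : V)) F : coindModule (repSub V V' ρ))) :
            C(V, M)) 1) = ρ (((s : V) : Γ)) (ρ g (((F : coindModule (repSub V V' ρ)) : C(V, M)) 1))
        rw [coindRep_apply_apply, one_mul]
        have key := (mem_coind_iff (repSub V V' ρ) _).1 F.2 (subOfConj V V' g s) 1
        rw [mul_one] at key
        change ρ g (((F : coindModule (repSub V V' ρ)) : C(V, M)) ((subOfConj V V' g s : (V'.subgroupOf V)) : V)) = _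
        rw [key]
        change ρ g (ρ ((g⁻¹ * ((s : V) : Γ) * g)) (((F : coindModule (repSub V V' ρ)) : C(V, M)) 1)) = _
        rw [mul_assoc, map_mul, Module.End.mul_apply, ← Module.End.mul_apply (ρ g), ← map_mul,
          mul_inv_cancel, map_one, Module.End.one_apply, map_mul, Module.End.mul_apply] }

omit [T2Space Γ] [TotallyDisconnectedSpace Γ] hV' in
/-- **`sh ∘ Θ_g = (g ·) ∘ sh`**: both composites are the map of the pair `(s ↦ g⁻¹sg, F ↦ g·F(1))`.
[cite: SerreGaloisCohomology1997, I §2.5] -/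
theorem shMap_thetaConj (q : ℕ) (y : continuousCohomology q (coindSub V V' ρ).toTopRep) :
    shMap (V'.subgroupOf V) (ρ.restrict (subgroupIncl V)) q (thetaConj V V' ρ g q y) =
      conjMapSubOf V V' ρ g q (shMap (V'.subgroupOf V) (ρ.restrict (subgroupIncl V)) q y) := by
  have h1 : shMap (V'.subgroupOf V) (ρ.restrict (subgroupIncl V)) q (thetaConj V V' ρ g q y) =
      ContinuousCohomology.map ((subgroupConj V g).comp (subgroupIncl (V'.subgroupOf V)))
        (evalOneConjSub V V' ρ g) q y :=
    (map_comp_apply_of (X := (coindSub V V' ρ).toTopRep) (Y := (coindSub V V' ρ).toTopRep)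
      (Z := (repSub V V' ρ).toTopRep) (subgroupConj V g) (subgroupIncl (V'.subgroupOf V))
      ((subgroupConj V g).comp (subgroupIncl (V'.subgroupOf V)))
      (fun _ => rfl) (coindSubConjHom V V' ρ g) (coindEvalOne (repSub V V' ρ)) (evalOneConjSub V V' ρ g)
      (fun F => by
        change ρ g (((F : coindModule (repSub V V' ρ)) : C(V, M)) 1) =
          ρ g (((F : coindModule (repSub V V' ρ)) : C(V, M)) (subgroupConj V g 1))
        rw [map_one (subgroupConj V g)]) q y).symm
  have h2 : conjMapSubOf V V' ρ g q (shMap (V'.subgroupOf V) (ρ.restrict (subgroupIncl V)) q y) =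
      ContinuousCohomology.map ((subgroupConj V g).comp (subgroupIncl (V'.subgroupOf V)))
        (evalOneConjSub V V' ρ g) q y :=
    (map_comp_apply_of (X := (coindSub V V' ρ).toTopRep) (Y := (repSub V V' ρ).toTopRep)
      (Z := (repSub V V' ρ).toTopRep) (subgroupIncl (V'.subgroupOf V)) (subOfConj V V' g)
      ((subgroupConj V g).comp (subgroupIncl (V'.subgroupOf V)))
      (fun _ => rfl) (coindEvalOne (repSub V V' ρ)) (subOfConjRepHom V V' ρ g) (evalOneConjSub V V' ρ g)
      (fun _ => rfl) q y).symm
  rw [h1, h2]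

variable [Fintype (V ⧸ (V'.subgroupOf V))]

/-- `F ↦ g · N(F)` along `c_g : V → V` — the module half of the pair computing BOTH `H(N) ∘ Θ_g` and
`(g ·) ∘ H(N)` (they agree because `N ∘ T_g = g ∘ N`). [cite: SerreGaloisCohomology1997, I §2.5] -/
def normConjHom :
    TopRep.res (subgroupConj V g : V →* V) (coindSub V V' ρ).toTopRep ⟶ (ρ.restrict (subgroupIncl V)).toTopRep :=
  TopRep.ofHom
    { toLinearMap := (ρ g).comp
        (normCoind (S := V'.subgroupOf V) (ρ.restrict (subgroupIncl V))).hom.toLinearMap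
      cont := continuous_of_discreteTopology
      isIntertwining' := fun x => by
        ext F
        have hc : (normCoind (S := V'.subgroupOf V) (ρ.restrict (subgroupIncl V))).hom
              ((coindSub V V' ρ) (subgroupConj V g x) F) =
            ρ ((g⁻¹ * (x : Γ) * g)) ((normCoind (S := V'.subgroupOf V) (ρ.restrict (subgroupIncl V))).hom F) :=
          TopRep.hom_comm_apply (normCoind (S := V'.subgroupOf V) (ρ.restrict (subgroupIncl V))) _ _
        change ρ g ((normCoind (S := V'.subgroupOf V) (ρ.restrict (subgroupIncl V))).hom
            ((coindSub V V' ρ) (subgroupConj V g x) F)) =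
          ρ ((x : Γ)) (ρ g ((normCoind (S := V'.subgroupOf V) (ρ.restrict (subgroupIncl V))).hom F))
        rw [hc, mul_assoc, map_mul, Module.End.mul_apply, ← Module.End.mul_apply (ρ g), ← map_mul,
          mul_inv_cancel, map_one, Module.End.one_apply, map_mul, Module.End.mul_apply] }

omit [T2Space Γ] [TotallyDisconnectedSpace Γ] hV' in
/-- **`H(N) ∘ Θ_g = (g ·) ∘ H(N)`** on `H^q(V, M_V^S(M)) → H^q(V, M)`.
[cite: SerreGaloisCohomology1997, I §2.5] [cite: NeukirchSchmidtWingberg2008, I §5 Prop. 1.5.4] -/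
theorem cohomologyMap_normCoind_thetaConj (q : ℕ) (y : continuousCohomology q (coindSub V V' ρ).toTopRep) :
    cohomologyMap (normCoind (S := V'.subgroupOf V) (ρ.restrict (subgroupIncl V))) q (thetaConj V V' ρ g q y) =
      conjMap ρ.toTopRep V g q
        (cohomologyMap (normCoind (S := V'.subgroupOf V) (ρ.restrict (subgroupIncl V))) q y) := by
  have h1 : cohomologyMap (normCoind (S := V'.subgroupOf V) (ρ.restrict (subgroupIncl V))) q
        (thetaConj V V' ρ g q y) =
      ContinuousCohomology.map (subgroupConj V g) (normConjHom V V' ρ g) q y :=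
    (map_comp_apply_of (X := (coindSub V V' ρ).toTopRep) (Y := (coindSub V V' ρ).toTopRep)
      (Z := (ρ.restrict (subgroupIncl V)).toTopRep) (subgroupConj V g) (ContinuousMonoidHom.id V)
      (subgroupConj V g) (fun _ => rfl) (coindSubConjHom V V' ρ g)
      (resIdHom (normCoind (S := V'.subgroupOf V) (ρ.restrict (subgroupIncl V)))) (normConjHom V V' ρ g)
      (fun F => (normCoind_coindSubConjHom V V' ρ g F).symm) q y).symm
  have h2 : conjMap ρ.toTopRep V g q
        (cohomologyMap (normCoind (S := V'.subgroupOf V) (ρ.restrict (subgroupIncl V))) q y) =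
      ContinuousCohomology.map (subgroupConj V g) (normConjHom V V' ρ g) q y :=
    (map_comp_apply_of (X := (coindSub V V' ρ).toTopRep) (Y := (ρ.restrict (subgroupIncl V)).toTopRep)
      (Z := (ρ.restrict (subgroupIncl V)).toTopRep) (ContinuousMonoidHom.id V) (subgroupConj V g)
      (subgroupConj V g) (fun _ => rfl)
      (resIdHom (normCoind (S := V'.subgroupOf V) (ρ.restrict (subgroupIncl V))))
      (conjRepHom ρ.toTopRep V g) (normConjHom V V' ρ g) (fun _ => rfl) q y).symm
  rw [h1, h2]

/-- **`cor_{V/V'} ∘ (g ·) = (g ·) ∘ cor_{V/V'}`** on `H^q(V'.subgroupOf V, M) → H^q(V, M)`, every degree `q`: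
the corestriction of the profinite group `↥V` along `V'.subgroupOf V` commutes with the action of any
`g ∈ Γ` normalising `V` and `V'`. [cite: NeukirchSchmidtWingberg2008, I §5 Prop. 1.5.4] [cite: SerreGaloisCohomology1997, I §2.5] -/
theorem cor_conjMapSubOf (q : ℕ) (z : continuousCohomology q (repSub V V' ρ).toTopRep) :
    cor (V'.subgroupOf V) (ρ.restrict (subgroupIncl V)) q (conjMapSubOf V V' ρ g q z) =
      conjMap ρ.toTopRep V g q (cor (V'.subgroupOf V) (ρ.restrict (subgroupIncl V)) q z) := by
  obtain ⟨y, hy⟩ := shapiro_map_surjective (repSub V V' ρ) q z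
  have hy' : shMap (V'.subgroupOf V) (ρ.restrict (subgroupIncl V)) q y = z := hy
  have h1 : extMap (V'.subgroupOf V) (ρ.restrict (subgroupIncl V)) q (conjMapSubOf V V' ρ g q z) =
      thetaConj V V' ρ g q y := by
    apply shapiro_map_injective (repSub V V' ρ) q
    change shMap (V'.subgroupOf V) (ρ.restrict (subgroupIncl V)) q
        (extMap (V'.subgroupOf V) (ρ.restrict (subgroupIncl V)) q (conjMapSubOf V V' ρ g q z)) =
      shMap (V'.subgroupOf V) (ρ.restrict (subgroupIncl V)) q (thetaConj V V' ρ g q y)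
    rw [sh_extMap, shMap_thetaConj, hy']
  have h2 : extMap (V'.subgroupOf V) (ρ.restrict (subgroupIncl V)) q z = y := by
    apply shapiro_map_injective (repSub V V' ρ) q
    change shMap (V'.subgroupOf V) (ρ.restrict (subgroupIncl V)) q
        (extMap (V'.subgroupOf V) (ρ.restrict (subgroupIncl V)) q z) =
      shMap (V'.subgroupOf V) (ρ.restrict (subgroupIncl V)) q y
    rw [sh_extMap, hy']
  rw [cor_apply, cor_apply, h1, h2, cohomologyMap_normCoind_thetaConj]

/-! ### §4 The relative corestriction `relCor : H^q(V', M) → H^q(V, M)` and its equivariance -/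

/-- **The relative corestriction `cor_{V/V'} : H^q(V', M) → H^q(V, M)`** for closed subgroups `V' ≤ V`
of `Γ` with `[V : V']` finite: the all-degree corestriction `cor` of the profinite group `↥V` along
`V'.subgroupOf V` (`Corestriction.lean`) after the tautological comparison `toSubgroupOf`
(`ContinuousCorestriction.lean`) — the transition map of the inverse system `(H^q(V_n, M))_n` along a
tower of open subgroups. [cite: SerreGaloisCohomology1997, I §2.5] [cite: NeukirchSchmidtWingberg2008, I §5 Prop. 1.5.3] -/
def relCor (q : ℕ) :
    continuousCohomology q (ρ.restrict (subgroupIncl V')).toTopRep ⟶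
      continuousCohomology q (ρ.restrict (subgroupIncl V)).toTopRep :=
  toSubgroupOf ρ.toTopRep h q ≫ cor (V'.subgroupOf V) (ρ.restrict (subgroupIncl V)) q

omit hVn hV'n in
/-- Unfolding `relCor`. [cite: SerreGaloisCohomology1997, I §2.5] -/
theorem relCor_apply (q : ℕ) (z : continuousCohomology q (ρ.restrict (subgroupIncl V')).toTopRep) :
    relCor V V' ρ h q z =
      cor (V'.subgroupOf V) (ρ.restrict (subgroupIncl V)) q (toSubgroupOf ρ.toTopRep h q z) := rfl

omit hVn hV'n in
/-- `relCor` read on `H^q(V'.subgroupOf V, M)`: `relCor (ofSubgroupOf z) = cor z`. [cite: SerreGaloisCohomology1997, I §2.5] -/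
theorem relCor_ofSubgroupOf (q : ℕ) (z : continuousCohomology q (repSub V V' ρ).toTopRep) :
    relCor V V' ρ h q (ofSubgroupOf V V' ρ h q z) = cor (V'.subgroupOf V) (ρ.restrict (subgroupIncl V)) q z := by
  rw [relCor_apply, toSubgroupOf_ofSubgroupOf]

/-- **MAIN STATEMENT — `relCor (g · z) = g · relCor z`**: the relative corestriction
`H^q(V', M) → H^q(V, M)` along closed normal subgroups `V' ≤ V` of a profinite group `Γ`, `[V : V']`
finite, commutes with the action of every `g ∈ Γ` on both sides, in every degree `q` — the compatible
families `(y_n)_n ∈ ∏_n H^q(V_n, M)`, `cor y_{n+1} = y_n`, along a tower of open normal subgroups are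
stable under `Γ`, so that `lim←_n H^q(V_n, M)` is a `Γ/⋂V_n`-module (and a module over the completed group
ring). [cite: NeukirchSchmidtWingberg2008, I §5 Prop. 1.5.4] [cite: SerreGaloisCohomology1997, I §2.5] -/
theorem relCor_conjMap (q : ℕ) (z : continuousCohomology q (ρ.restrict (subgroupIncl V')).toTopRep) :
    relCor V V' ρ h q (conjMap ρ.toTopRep V' g q z) = conjMap ρ.toTopRep V g q (relCor V V' ρ h q z) := by
  rw [relCor_apply, relCor_apply, toSubgroupOf_conjMap, cor_conjMapSubOf]

end RelCor

end Literature.NumberTheory.GaloisRepresentations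

end
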